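import Summits.QuantumFields.YangMills.Theses.UnitScaleTilt
import Literature.MathematicalPhysics.QuantumFieldTheory.Balaban1983to89.T3PrintedRegularMinimiser
import Literature.MathematicalPhysics.QuantumFieldTheory.Balaban1983to89.T3SmallLiftHistory
import Literature.MathematicalPhysics.QuantumFieldTheory.Balaban1983to89.T3AlphaInputsACTwoRun
import Summits.QuantumFields.YangMills.Theorems.UnitScaleTiltFluctuationComparisonRegPrOneStepSubmersion
import Summits.QuantumFields.YangMills.Theorems.UnitScaleTiltFluctuationComparisonRegPrSocket
import Summits.QuantumFields.YangMills.Theorems.AlphaInputsT3AC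
import Summits.QuantumFields.YangMills.Theorems.UnitScaleTiltFluctuationComparisonRegPrLevelCauchyMin
import Summits.QuantumFields.YangMills.Theorems.UnitScaleTiltFluctuationComparisonRegPrLevelCauchyMinT
import Summits.QuantumFields.YangMills.Theorems.UnitScaleTiltFluctuationComparisonRegPrAlphaTwoRunAdapterT
import Summits.QuantumFields.YangMills.Theorems.UnitScaleTiltFluctuationComparisonRegPrRepAtHeightsV3Fam
import Summits.QuantumFields.YangMills.Theorems.AlphaInputsT3ACv3Data
import Summits.QuantumFields.YangMills.Theorems.UnitScaleTiltFluctuationComparisonRegPrGlobalSlack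
import HarnessLib

/-
# v5j‴ (OWNER, ym3-torus-plan g20, 2026-08-27; RULING g20-№11 / №12) — skeleton of record for stmt-QuantumFields-19935 `FluctuationComparisonRegPrL` after registration.
# = v5j′ REV 2 (15c9339353bfc2e7, of record) with STUB 3″′ `stub_pintDecompTwoRunMinFam` ((B) `PintDecompTrivT` ∧ (C) `TwoRunMinT`, pure relative rate at every
# co-height — F-idea1-g10-1: HARDER THAN PRINT) RE-CUT to STUB 3⁗ `stub_globalTwoRunSlackFam`: for a coherent admissible family of v3 packages, ONE GLOBAL TWO-RUN ROW WITH
# KING'S ADDITIVE SLACK `GlobalSupRateTSlack (dataOfV3 p π) b₀ p₀ a σ C`, `σ ≥ 7`, `C ≥ 0` ([King1986] Thm 3.4 (3.9) p.656 in the T³ dictionary; σ > 2d = print's «power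
# greater than six», [Balaban1985UV3] (57) p.270).  The final consumer `LogComparisonSocket.stubBody_of_rep_of_cauchy` reads only `RepAtHeights ∧ CauchyAtHeights`; (B) and the
# per-polymer structure `π`/`PT`/`TwoRunMinT` were scaffolding for the per-polymer path to `CauchyAtHeights` (p509040) and LEAVE the registered cone (they stay in the tree as the
# pure sufficient path: `slack_of_pure`, `twoRunMinT_blocks_of_global`).  S-E″ := the slack consumer `levelCauchyOfGlobalSupRateTSlack_dec` (ideator 1, sorry-free; to be
# LANDED tree-first: p523985 `Theorems/UnitScaleTiltFluctuationComparisonRegPrGlobalSlack.lean`, ns `…Theorems.GlobalSlack`, port by ym3-torus-p2 g13 of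
# ym-cruxidea-19201-1 g10's `Sketch_ideator1_g10.lean` §1–§5, sorry 0, axioms standard).  STUB 1 / 2′ / 4′ VERBATIM (v5j′ r2); STUB 1 stays RE-LISTED (DE-NATIVE of `…CertL3Tree` not yet landed, №9).
# FOUR active stubs {stub_oneStepSmallLift, stub_laneRecordsV3, stub_globalTwoRunSlackFam, stub_logComparisonSmallBlocks}; sorries ONLY there.
-/

noncomputable section



namespace Summit.QuantumFields.YangMills.Cruxes.FluctuationComparisonRegPrL.BirthV5j3

open MeasureTheory Filter Topology
open Literature.MathematicalPhysics.QuantumFieldTheory.Balaban1983to89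
open Literature.MathematicalPhysics.QuantumFieldTheory.Balaban1983to89.T3ContinuumYM3Torus
open Literature.MathematicalPhysics.QuantumFieldTheory.Balaban1983to89.T3LevelShift
open Literature.MathematicalPhysics.QuantumFieldTheory.Balaban1983to89.T3UnitLawDensityEML (ℰp measurableE_ℰp)
open Literature.MathematicalPhysics.QuantumFieldTheory.Balaban1983to89.T3UnitScaleTilt
open Literature.MathematicalPhysics.QuantumFieldTheory.Balaban1983to89.T3RestrictedUnitDensity
open Literature.MathematicalPhysics.QuantumFieldTheory.Balaban1983to89.T3TiltDescent
open Literature.MathematicalPhysics.QuantumFieldTheory.Balaban1983to89.T3ConstrainedMinimiser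
open Literature.MathematicalPhysics.QuantumFieldTheory.Balaban1983to89.T3RegularMinimiser
open Literature.MathematicalPhysics.QuantumFieldTheory.Balaban1983to89.T3PrintedRegularMinimiser
open Literature.MathematicalPhysics.QuantumFieldTheory.Balaban1983to89.T3SmallLiftHistory
open Literature.MathematicalPhysics.QuantumFieldTheory.Balaban1983to89.T3LogComparisonSocket
open Literature.MathematicalPhysics.QuantumFieldTheory.Balaban1983to89.T3AlphaInputsAC
open Literature.MathematicalPhysics.QuantumFieldTheory.Balaban1983to89.T3AlphaInputsACTwoRun
open Literature.MathematicalPhysics.QuantumFieldTheory.Balaban1983to89.T3AlphaInputsACTwoRunLevel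
open Literature.MathematicalPhysics.QuantumFieldTheory.Balaban1983to89.Missing
open Literature.MathematicalPhysics.QuantumFieldTheory.Balaban1983to89.T4Continuum

/-! ## §1 Registered stubs (sorries live ONLY here) -/

/-- STUB 1 (L; W7) — RE-LISTED AS AN EXPLICIT HYPOTHESIS at v5j′ REV 2 (owner ym3-torus-plan g20, 2026-08-27, F-owner-g20-2): its proof of record
`Theorems.ApproxLift.AnsatzT.stub_oneStepSmallLift` (p490827) is LANDED but its L = 3 branch rests on FIVE `native_decide` certificates
(`…FluctuationComparisonRegPrCertL3Tree` `faceQ`/`sneutralQ`/`massQ`/`chainMassQ`/`rowsQ`, axioms `…_native.native_decide.ax_1_1` ∉ {propext, Classical.choice, Quot.sound}),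
which the gate's skeleton/closure policy does not admit («axioms never close anything — prove it or make it an explicit listed hypothesis»); it is therefore a
STUB again until a kernel-checked (de-nativised) proof of the same five certificate theorems lands, after which it closes BY NAME with the text below unchanged
(byte-identical with v5h's STUB 1) — ONE-STEP SMALL LIFT with gain `κ√L ≤ 1` for every family of block size `L` (linearisation certified; non-linear step =
implicit function on `SU(2)^{bonds}`). [cite: Balaban1987RG1, (0.4)/(0.18) p.253] -/
theorem stub_oneStepSmallLift :
    ∀ L : ℕ, ∃ κ δ₀ : ℝ, κ * Real.sqrt L ≤ 1 ∧ 0 < δ₀ ∧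
      ∀ F : T3Family, F.L = L → OneStepSmallLift F ℰp κ δ₀ := by
  sorry

/-- LANDED (was STUB 2 of v3, `stub_oneStepSubmersion`): the ONE-STEP SUBMERSION (O) ∧ (N) of the (0.4)/EML averaging on small `SU(2)`
fields — PROVED by the fleet lead ym-ust-19201-p1, `Theorems.OneStepSubmersion.oneStepSubmersion_family` (p446430; engines p443878 fibrewise
submersion, p444734/p445163 parametric IFT on `SU(2)` in the cone picture, p445817 analytic datum of the EML fibre map).  Renamed `landed_…` so the
registrar does not resurrect it as a stub (cf. 19200 v3d). [cite: Balaban1987RG1, (0.4) p.253] -/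
theorem landed_oneStepSubmersion :
    ∀ L : ℕ, ∃ δ₁ : ℝ, 0 < δ₁ ∧ ∀ F : T3Family, F.L = L → ∀ K j : ℕ, j + 1 ≤ F.m + K →
      (∀ O : Set (GaugeField (F.P K) j (Matrix.specialUnitaryGroup (Fin 2) ℂ)), IsOpen O → O ⊆ {U | PlaqSmall δ₁ U} →
        IsOpen ((BlockAveraging.blockAvg (P := F.P K) (j := j) ℰp).avg '' O)) ∧
      (∀ O : Set (GaugeField (F.P K) j (Matrix.specialUnitaryGroup (Fin 2) ℂ)), IsOpen O → O ⊆ {U | PlaqSmall δ₁ U} →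
        ∀ A : Set (GaugeField (F.P K) (j + 1) (Matrix.specialUnitaryGroup (Fin 2) ℂ)), MeasurableSet A →
          fieldMeasure (F.P K) j (Matrix.specialUnitaryGroup (Fin 2) ℂ)
              (O ∩ (BlockAveraging.blockAvg (P := F.P K) (j := j) ℰp).avg ⁻¹' A) = 0 →
            fieldMeasure (F.P K) (j + 1) (Matrix.specialUnitaryGroup (Fin 2) ℂ)
              (A ∩ (BlockAveraging.blockAvg (P := F.P K) (j := j) ℰp).avg '' O) = 0) :=
  Summit.QuantumFields.YangMills.Theorems.OneStepSubmersion.oneStepSubmersion_family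

/-- STUB 2′ (XXL but LANE-OWNED; owner's `stub_laneRecordsV3`, RULING g18-№3 §3 / SUPPLEMENT A / g19-№2; the END theorem of cell pub-balaban3d modulo NODE O, run with the
power-counting profile as a PARAMETER) — BAŁABAN'S (α) INPUT ROWS, VERSION 3, HOLD FOR THE PINNED CARRIER AT EVERY SUFFICIENTLY LARGE PROFILE: for every admissible block size
there are thresholds `(b₁, p₁)` such that every profile `(b₀, p₀) ⪰ (b₁, p₁)` is the profile of SOME primitive-constants record `𝔠 : AlphaConsts L 2` (`𝔠.b₀ = b₀`,
`𝔠.p₀ = p₀`) with [7]-constants `a₀ a₁` bound with the record, whose v3 AC (α) rows `AlphaInputsT3AC.OfV3At F 𝔠 a₀ a₁` hold for every family with `F.L = L` — ★alpha-1's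
closed Prop `Theorems.AlphaInputsT3ACv3Rec L` BY NAME.  v3 = the (β) residual rows are print's (55) WITH `χ_{k+1}` on the right and (57), over PINNED exact-transport masses
(`MassesPAC`, `m(triv) = 1`), the Jacobian of `blockAvg ℰp` inside the step pieces at (46)-size; exact Haar compatibility E6′ is NOT a row (replaces v2's `AlphaInputsT3ACv2Rec`,
retired by located point P-g18-1).  SHARED verbatim with the `HistoryTailL` (stmt-QuantumFields-19936) skeleton v5p6. [cite: Balaban1985UV3, Thm 1 p.257, (7) p.257, (55) p.269 and Thm 2 p.272] -/
theorem stub_laneRecordsV3 : ∀ L : ℕ, Odd L → 1 < L → Summit.QuantumFields.YangMills.Theorems.AlphaInputsT3ACv3Rec L := by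
  sorry

/-- STUB 3⁗ (XL, THE CORE; OWNER RULING g20-№11 re-cut of 3″′ after F-idea1-g10-1): FOR A CONSTANTS RECORD `𝔠` WITH [7]-CONSTANTS `a₀ a₁` there are ONE exponent
`a(𝔠) > 0` and a coupling threshold `γB(𝔠) > 0` such that for every family of block size `L`, every admissible coupling below it and every inhabitant `h` of the v3 package
there is a COHERENT ADMISSIBLE FAMILY of v3 packages `p : ∀ K, PkgAtV3 F 𝔠 γ hγ hγ1 K` carrying the given constants, a polymer parameter `π`, an order `σ ≥ 7` and a constant
`C ≥ 0` with, for the family's datum `AlphaInputsT3AC.dataOfV3 p π`, THE GLOBAL TWO-RUN ROW WITH KING'S ADDITIVE SLACK on the `θ(n)`-window at EVERY co-height `n ≤ K`: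
`|PintH (K+1) n V − PintH K n V − c K n| ≤ C·#Site(F.P n)·(θ(n)²·L^{−a(K−n)} + θ(n)^σ)` with datum-independent shifts `c K n` — [King1986] Thm 3.4 (3.9) in the T³
dictionary (`L^kε ↦ L^{−n}`, `|T| ↦ #Site`, `θ(n)² ≍ γL^{−n}·polylog`): what an order-`σ` two-run Taylor / cluster comparison with matched height-free kernels delivers
(located, UNPRINTED for non-abelian d = 3 — the residual of the crux).  The family is ∃-quantified ONCE for all `K`; `h` certifies that admissible packages exist at every `K`.
The pure-rate form (`GlobalSupRateT`, no `θ(n)^σ` term; v5j′ r2's (C) `TwoRunMinT`/`PolymerCauchyMinAtT`) implies it (`slack_of_pure`) and is all-order at fixed height.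
RATE-HALF NORMALISATION (ym3-torus-lit L-22, located): print's (3.9) rate term carries the LOSS `(L^kε_K)^{−β}`, β ≥ d + ½, and is used at ONE height (3.12); this
row keeps the cell's window normalisation `θ(n)²` (fields on the `θ(n)`-window are `O(θ(n))`, matched monomials have degree ≥ 2; both ideators' text, = W0/W1 of
F-C7-2) at every co-height.  OWNER PRE-AUTHORISATION: should a prover show that the printed method delivers only a polynomial loss `L^{βn}` in the rate half, the
owner weakens this row to `C·#Site·(L^{βn}·L^{−a(K−n)} + θ(n)^σ)` with `∃ β ≥ 0` bound next to `∃ a` — consumer-neutral (only `m₀(a) ↦ m₀(a, β)` in S-E″), one registry event.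
[cite: King1986, Thm 3.4 (3.9) p.656; Balaban1985UV3, (43)-(46) pp.266-267 and (57) p.270] -/
theorem stub_globalTwoRunSlackFam :
    ∀ (L : ℕ), Odd L → 7 ≤ L → ∀ (𝔠 : Summit.QuantumFields.Balaban3D.Proofs.Primitives.AlphaConsts L (Summit.QuantumFields.Balaban3D.Carriers.suGroupModel 2).N)
      (a₀ a₁ : ℝ), 0 < a₀ → 0 < a₁ → 𝔠.B₃ * a₁ ≤ a₀ →
      ∃ a : ℝ, 0 < a ∧ ∃ γB : ℝ, 0 < γB ∧ ∀ (F : T3Family) (γ : ℝ) (hF : F.L = L) (hγ : 0 < γ), γ ≤ γB →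
        ∀ (hγ1 : γ ≤ (min (hF ▸ 𝔠).gamma0 1) ^ 2),
          Summit.QuantumFields.YangMills.Theorems.AlphaInputsT3AC.OfV3At F (hF ▸ 𝔠) a₀ a₁ →
          ∃ (p : ∀ K, Summit.QuantumFields.YangMills.Theorems.AlphaInputsT3AC.PkgAtV3 F (hF ▸ 𝔠) γ hγ hγ1 K),
            (∀ K, (p K).a₀ = a₀ ∧ (p K).a₁ = a₁) ∧
            ∃ (π : Summit.QuantumFields.YangMills.Theorems.AlphaInputsT3AC.PolymerT3 F) (σ : ℕ) (C : ℝ), 7 ≤ σ ∧ 0 ≤ C ∧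
              Summit.QuantumFields.YangMills.Theorems.GlobalSlack.GlobalSupRateTSlack (Summit.QuantumFields.YangMills.Theorems.AlphaInputsT3AC.dataOfV3 p π) (hF ▸ 𝔠).b₀ (hF ▸ 𝔠).p₀ a σ C := by
  sorry

/-- S-E″ OVER THE SLACK ROW (pure counting; ideator 1's `levelCauchyOfGlobalSupRateTSlack_dec`, §0 — LANDED AS A THEOREMS FILE BEFORE REGISTRATION): for EVERY exponent
`a > 0`, with `m₀ = ⌈(3+a)/a⌉ + 1` and NO real threshold (`ε₁ = γ₁ = 1`): `GlobalSupRateTSlack D b₀ p₀ a σ C` with `σ ≥ 7`, `C ≥ 0` gives the cut-off-Cauchy property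
`CauchyAtHeights D b₀ p₀ m` (sharp profile `θ(i) ≤ C_c g_i^{1−c}`, `c = 1/8`, `ρ = L^{−7/16}`, `ρ^σL³ < 1` iff `σ ≥ 7`). [cite: King1986, Thm 3.4 (3.9) p.656 and (3.12)-(3.13) p.657] -/
theorem landed_levelCauchyOfGlobalSupRateTSlack :
    ∀ (L : ℕ), Odd L → 1 < L → ∀ (a : ℝ), 0 < a →
      ∃ ε₁ : ℝ, 0 < ε₁ ∧ ∀ (ε₀ : ℝ), 0 < ε₀ → ε₀ ≤ ε₁ → ∃ m₀ : ℕ, ∀ (m : ℕ), m₀ ≤ m → ∀ (b₀ p₀ : ℝ), 0 < b₀ → 2 < p₀ →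
        ∃ γ₁ : ℝ, 0 < γ₁ ∧ ∀ (F : T3Family) (γ : ℝ), F.L = L → 0 < γ → γ ≤ γ₁ →
          ∀ (D : AlphaDataT3 F γ) (σ : ℕ) (C : ℝ), 7 ≤ σ → 0 ≤ C → Summit.QuantumFields.YangMills.Theorems.GlobalSlack.GlobalSupRateTSlack D b₀ p₀ a σ C → CauchyAtHeights D b₀ p₀ m :=
  Summit.QuantumFields.YangMills.Theorems.GlobalSlack.levelCauchyOfGlobalSupRateTSlack_dec

/-- STUB 4′ — SMALL-BLOCK SUPPLEMENT (rank-last; XL; located-UNPRINTED; owner rulings g16-№1 / g17-№1): the v2–v4 registered STUB-3 body ON odd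
`L < 7`, i.e. L ∈ {3, 5} (the block sizes at which the large-L line cannot run AS TYPED — socket window edge band, FINDING #44/#56 on 19201), in the
ERRATUM-v3′ THRESHOLD FORM: thresholds `(b₁, p₁)` FIRST, then the profile, then `ε₁, m₀, γ₁`.  Line foreseen: (R1) print's χ back / (R2′) shrunken
window inside the proof / (R0) height guard — see the v5d docstring on the aside item; not staffed before the large-L chain closes.
[cite: Balaban1985UV3, (47) p.267; King1986, Thm 3.4 (3.9) p.656] -/
theorem stub_logComparisonSmallBlocks :
    ∀ (L : ℕ), Odd L → 1 < L → L < 7 → ∃ (b₁ p₁ : ℝ), ∀ (b₀ p₀ : ℝ), b₁ ≤ b₀ → p₁ ≤ p₀ → 0 < b₀ → 2 < p₀ →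
      ∃ ε₁ : ℝ, 0 < ε₁ ∧ ∀ (ε₀ : ℝ), 0 < ε₀ → ε₀ ≤ ε₁ → ∃ m₀ : ℕ, ∀ (m : ℕ), m₀ ≤ m →
        ∃ γ₁ : ℝ, 0 < γ₁ ∧ ∀ (F : T3Family) (γ : ℝ), F.L = L → 0 < γ → γ ≤ γ₁ →
          ∃ (r κ : ℕ → ℝ), Summable r ∧ (∀ K, 0 ≤ r K) ∧
            ∀ K, ∀ᵐ V ∂fieldMeasure (F.P (K / m)) 0 (Matrix.specialUnitaryGroup (Fin 2) ℂ),
              PlaqSmall (θBal F.L γ b₀ p₀ (K / m)) V →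
                0 < heightDensity F γ (Nat.div_le_self K m) (histGood F ℰp (θBal F.L γ b₀ p₀) K (K / m)) V →
                0 < heightDensity F γ ((Nat.div_le_self K m).trans (Nat.le_succ K))
                      (histGood F ℰp (θBal F.L γ b₀ p₀) (K + 1) (K / m)) V →
                  |(Real.log (heightDensity F γ ((Nat.div_le_self K m).trans (Nat.le_succ K))
                        (histGood F ℰp (θBal F.L γ b₀ p₀) (K + 1) (K / m)) V) + bgRegPr' F γ m ε₀ K V) -
                    (Real.log (heightDensity F γ (Nat.div_le_self K m) (histGood F ℰp (θBal F.L γ b₀ p₀) K (K / m)) V) + bgRegPr F γ m ε₀ K V) -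
                      κ K| ≤ r K := by
  sorry

/-! ## §2 The composition — NO sorry below this line -/

/-- **THE α-ADAPTER OVER `TermFn` AT THE v3 PACKAGE — A THEOREM** (v5i's STUB 3′ conclusion; RULING g19-№2 (2)): conjunct (A) by `AlphaInputsT3AC.repAtHeights_dataOfV3` for the family the stub provides (this seat's
`…RepAtHeightsV3Fam.lean`), the slack global two-run row by STUB 3⁗, thresholds `ε₁ := a₀`, `γ₁(𝔠, ε₀) := min(γB, γ_thresholds, (min γ₀ 1)²)` (`LogComparisonAlphaAdapter.exists_gamma_thresholds`,
p509517).  [cite: Balaban1985UV3, Thm 2 p.272; King1986, Prop. 3.8-3.9 pp.664-665] -/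
theorem alphaTwoRunOfLaneV3 :
    ∀ (L : ℕ), Odd L → 7 ≤ L → ∀ (𝔠 : Summit.QuantumFields.Balaban3D.Proofs.Primitives.AlphaConsts L (Summit.QuantumFields.Balaban3D.Carriers.suGroupModel 2).N)
      (a₀ a₁ : ℝ), 0 < a₀ → 0 < a₁ → 𝔠.B₃ * a₁ ≤ a₀ →
      ∃ ε₁ : ℝ, 0 < ε₁ ∧ ∃ a : ℝ, 0 < a ∧ ∀ (ε₀ : ℝ), 0 < ε₀ → ε₀ ≤ ε₁ →
        ∃ γ₁ : ℝ, 0 < γ₁ ∧ ∀ (F : T3Family) (γ : ℝ) (hF : F.L = L), 0 < γ → γ ≤ γ₁ →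
          Summit.QuantumFields.YangMills.Theorems.AlphaInputsT3AC.OfV3At F (hF ▸ 𝔠) a₀ a₁ →
            ∃ (D : AlphaDataT3 F γ), RepAtHeights D 𝔠.b₀ 𝔠.p₀ ε₀ ∧
              ∃ (σ : ℕ) (C : ℝ), 7 ≤ σ ∧ 0 ≤ C ∧ Summit.QuantumFields.YangMills.Theorems.GlobalSlack.GlobalSupRateTSlack D 𝔠.b₀ 𝔠.p₀ a σ C := by
  intro L hLo h7 𝔠 a₀ a₁ ha0 ha1 hw
  obtain ⟨a, ha, γB, hγB, hBC⟩ := stub_globalTwoRunSlackFam L hLo h7 𝔠 a₀ a₁ ha0 ha1 hw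
  refine ⟨a₀, ha0, a, ha, fun ε₀ hε hhi => ?_⟩
  obtain ⟨γT, hγT, -, hT⟩ := Summit.QuantumFields.YangMills.Theorems.LogComparisonAlphaAdapter.exists_gamma_thresholds
    (B₃ := 𝔠.B₃) 𝔠.b₀_pos 𝔠.p₀_pos ha1 𝔠.B₃_pos.le hε
  have hg0 : 0 < (min 𝔠.gamma0 1) ^ 2 := pow_pos (lt_min 𝔠.gamma0_pos one_pos) 2
  refine ⟨min γB (min γT ((min 𝔠.gamma0 1) ^ 2)), lt_min hγB (lt_min hγT hg0), fun F γ hF hγ hγ₁ hOf => ?_⟩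
  subst hF
  have hγB' : γ ≤ γB := hγ₁.trans (min_le_left _ _)
  have hγT' : γ ≤ γT := hγ₁.trans ((min_le_right _ _).trans (min_le_left _ _))
  have hγ1 : γ ≤ (min 𝔠.gamma0 1) ^ 2 := hγ₁.trans ((min_le_right _ _).trans (min_le_right _ _))
  obtain ⟨p, hp, π, σ, C, hσ, hC0, hG⟩ := hBC F γ rfl hγ hγB' hγ1 hOf
  obtain ⟨hT1, hT2, hT3⟩ := hT F.L F.hL.2.le γ hγ hγT'
  exact ⟨Summit.QuantumFields.YangMills.Theorems.AlphaInputsT3AC.dataOfV3 p π,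
    Summit.QuantumFields.YangMills.Theorems.AlphaInputsT3AC.repAtHeights_dataOfV3 p π hp ε₀ hε hhi hT1 hT2 hT3, σ, C, hσ, hC0, hG⟩

/-- The two-run log-comparison in the v3′ order (thresholds first): for each odd `L > 1` — L ≥ 7: thresholds from STUB 2′; for a profile beyond them the
record `𝔠` with `(𝔠.b₀, 𝔠.p₀) = (b₀, p₀)`; `ε₁(𝔠), a(𝔠)` from the α-adapter theorem `alphaTwoRunOfLaneV3` ((A) proved + STUB 3″); `m₀` from the landed S-E″ at `a`; per family the datum `D`, `CauchyAtHeights`, and the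
socket `LogComparisonSocket.stubBody_of_rep_of_cauchy` (p452026); L < 7: STUB 4′ verbatim. [cite: King1986, Thm 3.4 (3.9) p.656] -/
theorem logComparisonRegPrL :
    ∀ (L : ℕ), Odd L → 1 < L → ∃ (b₁ p₁ : ℝ), ∀ (b₀ p₀ : ℝ), b₁ ≤ b₀ → p₁ ≤ p₀ → 0 < b₀ → 2 < p₀ →
      ∃ ε₁ : ℝ, 0 < ε₁ ∧ ∀ (ε₀ : ℝ), 0 < ε₀ → ε₀ ≤ ε₁ → ∃ m₀ : ℕ, ∀ (m : ℕ), m₀ ≤ m →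
        ∃ γ₁ : ℝ, 0 < γ₁ ∧ ∀ (F : T3Family) (γ : ℝ), F.L = L → 0 < γ → γ ≤ γ₁ →
          ∃ (r κ : ℕ → ℝ), Summable r ∧ (∀ K, 0 ≤ r K) ∧
            ∀ K, ∀ᵐ V ∂fieldMeasure (F.P (K / m)) 0 (Matrix.specialUnitaryGroup (Fin 2) ℂ),
              PlaqSmall (θBal F.L γ b₀ p₀ (K / m)) V →
                0 < heightDensity F γ (Nat.div_le_self K m) (histGood F ℰp (θBal F.L γ b₀ p₀) K (K / m)) V →
                0 < heightDensity F γ ((Nat.div_le_self K m).trans (Nat.le_succ K))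
                      (histGood F ℰp (θBal F.L γ b₀ p₀) (K + 1) (K / m)) V →
                  |(Real.log (heightDensity F γ ((Nat.div_le_self K m).trans (Nat.le_succ K))
                        (histGood F ℰp (θBal F.L γ b₀ p₀) (K + 1) (K / m)) V) + bgRegPr' F γ m ε₀ K V) -
                    (Real.log (heightDensity F γ (Nat.div_le_self K m) (histGood F ℰp (θBal F.L γ b₀ p₀) K (K / m)) V) + bgRegPr F γ m ε₀ K V) -
                      κ K| ≤ r K := by
  intro L hLo hL
  by_cases h7 : 7 ≤ L
  swap
  · exact stub_logComparisonSmallBlocks L hLo hL (not_le.mp h7)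
  obtain ⟨b₁, p₁, hrec⟩ := stub_laneRecordsV3 L hLo hL
  refine ⟨b₁, p₁, fun b₀ p₀ hb1 hp1 hb hp => ?_⟩
  obtain ⟨𝔠, a₀, a₁, hcb, hcp, ha0, ha1, hw, h𝔠⟩ := hrec b₀ p₀ hb1 hp1
  subst hcb
  subst hcp
  obtain ⟨εa, hεa, a, ha, hA⟩ := alphaTwoRunOfLaneV3 L hLo h7 𝔠 a₀ a₁ ha0 ha1 hw
  obtain ⟨εs, hεs, hS⟩ := landed_levelCauchyOfGlobalSupRateTSlack L hLo hL a ha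
  refine ⟨min εa εs, lt_min hεa hεs, fun ε₀ h0 h1 => ?_⟩
  have h1a : ε₀ ≤ εa := h1.trans (min_le_left _ _)
  have h1s : ε₀ ≤ εs := h1.trans (min_le_right _ _)
  obtain ⟨m₀, hm₀⟩ := hS ε₀ h0 h1s
  refine ⟨max m₀ 1, fun m hm => ?_⟩
  have hmpos : 0 < m := Nat.lt_of_lt_of_le Nat.one_pos ((le_max_right _ _).trans hm)
  obtain ⟨γa, hγa, hA'⟩ := hA ε₀ h0 h1a
  obtain ⟨γs, hγs, hS'⟩ := hm₀ m ((le_max_left _ _).trans hm) 𝔠.b₀ 𝔠.p₀ hb hp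
  refine ⟨min γa γs, lt_min hγa hγs, fun F γ hF hγ hγ₁ => ?_⟩
  have hγa' : γ ≤ γa := hγ₁.trans (min_le_left _ _)
  have hγs' : γ ≤ γs := hγ₁.trans (min_le_right _ _)
  obtain ⟨D, hRep, σ, C, hσ, hC0, hG⟩ := hA' F γ hF hγ hγa' (h𝔠 F hF)
  have hCau : CauchyAtHeights D 𝔠.b₀ 𝔠.p₀ m := hS' F γ hF hγ hγs' D σ C hσ hC0 hG
  exact Summit.QuantumFields.YangMills.Theorems.LogComparisonSocket.stubBody_of_rep_of_cauchy F γ 𝔠.b₀ 𝔠.p₀ ε₀ hmpos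
    D.PintH D.EcstH D.RmH hRep hCau

/-- The old registered `stub_posOnSmall` (birth 04793f26c2da46ec), a THEOREM modulo STUB 1 ALONE (statement verbatim; «Lemma B» landed p446430; v5j′ REV 2: composed with the RE-LISTED `stub_oneStepSmallLift`, not with p494511 — F-owner-g20-2). -/
theorem posOnSmall :
    ∀ (L m : ℕ), 0 < m → ∀ (b₀ p₀ : ℝ), 0 < b₀ → 2 < p₀ → ∃ γ₁ : ℝ, 0 < γ₁ ∧
      ∀ (F : T3Family) (γ : ℝ), F.L = L → 0 < γ → γ ≤ γ₁ →
        ∀ K, ∀ᵐ V ∂fieldMeasure (F.P (K / m)) 0 (Matrix.specialUnitaryGroup (Fin 2) ℂ),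
          PlaqSmall (θBal F.L γ b₀ p₀ (K / m)) V →
            0 < heightDensity F γ (Nat.div_le_self K m) (histGood F ℰp (θBal F.L γ b₀ p₀) K (K / m)) V ∧
            0 < heightDensity F γ ((Nat.div_le_self K m).trans (Nat.le_succ K))
                  (histGood F ℰp (θBal F.L γ b₀ p₀) (K + 1) (K / m)) V :=
  -- v5j′ REV 2 (owner, F-owner-g20-2): CONDITIONAL on STUB 1 again — `posOnSmall_of_oneStepSmallLift` (p446430, axioms standard) ∘ `stub_oneStepSmallLift`; the
  -- unconditional p494511 `PosOnSmall.posOnSmall` composes with p490827 whose L = 3 branch carries `native_decide` axioms and is therefore not used in the cone.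
  Summit.QuantumFields.YangMills.Theorems.OneStepSubmersion.posOnSmall_of_oneStepSmallLift stub_oneStepSmallLift

/-- **`FluctuationComparisonRegPrL ⇐ stub_laneRecordsV3 ∧ stub_pintDecompTwoRunMinFam ∧ stub_logComparisonSmallBlocks`** (STUB 1 landed, (A) proved, S-E″ landed) — the NEW
load-bearing item stmt-QuantumFields-19935 BY NAME (S-E″ landed p479105/p479478; positivity via p446430 ∘ p443013 ∘ p428548; socket p452026). -/
theorem FluctuationComparisonRegPrL_of : Summit.QuantumFields.YangMills.Theses.UnitScaleTilt.FluctuationComparisonRegPrL := by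
  intro L
  by_cases hL : Odd L ∧ 1 < L
  · obtain ⟨b₁, p₁, hT⟩ := logComparisonRegPrL L hL.1 hL.2
    refine ⟨b₁, p₁, fun b₀ p₀ hb1 hp1 hb hp => ?_⟩
    obtain ⟨ε₁, hε₁, hε⟩ := hT b₀ p₀ hb1 hp1 hb hp
    refine ⟨ε₁, hε₁, fun ε₀ h0 h1 => ?_⟩
    obtain ⟨m₀, hm₀⟩ := hε ε₀ h0 h1
    refine ⟨max m₀ 1, fun m hm => ?_⟩
    have hm₀' : m₀ ≤ m := (le_max_left _ _).trans hm
    have hmpos : 0 < m := Nat.lt_of_lt_of_le Nat.one_pos ((le_max_right _ _).trans hm)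
    obtain ⟨γa, hγa, ha⟩ := posOnSmall L m hmpos b₀ p₀ hb hp
    obtain ⟨γb, hγb, hb'⟩ := hm₀ m hm₀'
    refine ⟨min γa γb, lt_min hγa hγb, fun F γ hFL hγ hγ₁ => ?_⟩
    have hP := ha F γ hFL hγ (hγ₁.trans (min_le_left _ _))
    obtain ⟨r, κ, hr, hr0, hC⟩ := hb' F γ hFL hγ (hγ₁.trans (min_le_right _ _))
    refine ⟨r, κ, hr, hr0, fun K => ?_⟩
    filter_upwards [hP K, hC K] with V hVp hVc
    intro hs
    obtain ⟨h0', h1'⟩ := hVp hs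
    exact ⟨h0', h1', hVc hs h0' h1'⟩
  · refine ⟨0, 0, fun b₀ p₀ _ _ _ _ => ⟨1, one_pos, fun ε₀ _ _ => ⟨0, fun m _ => ⟨1, one_pos, fun F γ hFL _ _ => ?_⟩⟩⟩⟩
    have hF := F.hL
    rw [hFL] at hF
    exact (hL hF).elim

end Summit.QuantumFields.YangMills.Cruxes.FluctuationComparisonRegPrL.BirthV5j3

end
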